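import Summits.Ventures.Crystal3D.Theorems.StickyWulffConstantGenericWallFloorDozenRigidity
import Summits.Ventures.Crystal3D.Theorems.StickyWulffConstantGenericWallFloorCommonSlots
import Summits.Ventures.Crystal3D.Theorems.StickyWulffConstantGenericWallFloorCapStartBarlowStep
import Summits.Ventures.Crystal3D.Theorems.StickyWulffConstantNoReconstructionGainBarlowGrainFrame
import Summits.Ventures.Crystal3D.Theorems.StickyWulffConstantTextureLiminfTexShadowCertificateDefs
import Literature.MathematicalPhysics.StatisticalMechanics.BarlowCoordination
import HarnessLib

/-!
# Barlow star rigidity (option (C), part (a′), algebra): a frame with three independent exact slots at a site of a Barlow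
# stacking carries the bilayer lattice `Λ₀` or its basal twin `M Λ₀`
# (crux `GenericWallFloor`, stmt-Ventures-19480, line `WallLedgerG`; cf-p1 DECISION (xxxvii⁵): OffR := `FramesApart`)

HONEST FRAMING. Venture `Summits/Ventures/Crystal3D` (cell `crystal3d-full`), helper `--supports` the crux `GenericWallFloor`
(stmt-Ventures-19480) of `route-Ventures-StickyWulffConstant`, registered line `WallLedgerG`, open stub `stub_twoSlabAdhesion`.
Structure only (census-free); F-C1 not moved; NOT the stub.

WHY.  Lane T's stub of record is keyed by the translation-FREE `FramesApart` (`…TexShadowCornerFramesDefs`): clause (i) says no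
frame of family 1 carries plate 2's bilayer lattice `L₂·Λ₀` or its basal twin `(twinFrame L₂ (L₂ e₃))·Λ₀`.  To make that clause do the
work of the positional reach hypothesis one needs: a certified walker standing deep inside plate 2 carries one of these two lattices on
top.  This file is the lattice algebra behind it (the sealed / walker statements are `…BarlowCoreAvoid`):
* **`barlow_bond_mem_or_mirror_mem`** — a bond `d` of ANY Barlow stacking `σ` (difference of two sites at distance `1`) lies on `Λ₀` or
  on `M Λ₀` (`M = basalMirror`): in-layer and `+`-bilayer bonds on `Λ₀`, `−`-bilayer bonds on `M Λ₀` (`dist_barlowPos_eq_iff` and the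
  bond identities of `…BarlowGrainFrame`).
* **`false_of_bond_and_mirror_bond`** — a rigid fcc lattice `G·Λ₀` never contains an out-of-plane bond of `Λ₀` together with an
  out-of-plane bond of `M Λ₀`: both inner products `⟪v, u⟫`, `⟪M v, u⟫ = ⟪v, u⟫ − 2 v₂ u₂` would be half-integers
  (`inner_mem_of_unit_slots`) while `2 v₂ u₂ = ± 4/3` (`fcc_unit_height`, `inner_basalMirror_left`).
* **`barlow_frame_eq_or_eq_mirror`** — BARLOW STAR RIGIDITY (model plate): a frame `G` with three linearly independent slots exact at a
  site of `barlowStacking σ` has `G·Λ₀ = Λ₀ ∨ G·Λ₀ = M·Λ₀` (`movedFcc_eq_of_three_independent_units`; at an h-site the up- and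
  down-bonds lie on different lattices and the no-mixing lemma forbids using both).
* **`barlow_frame_eq_or_eq_twin`** — moved plate `stacking L s σ`: `F·Λ₀ = L·Λ₀ ∨ F·Λ₀ = (twinFrame L (L e₃))·Λ₀`.
WHAT THIS IS NOT: no walker, no sealing, no count; F-C1 not moved.
-/

noncomputable section

namespace Summit.Ventures.Crystal3D.Theorems

open Finset
open Literature.MathematicalPhysics.StatisticalMechanics (barlowPos barlowStacking fccStacking constHagg basalMirror IsHaggSeq
  mem_barlowStacking_iff basalMirror_apply_coord dist_barlowPos_eq_iff)
open Summit.Ventures.Crystal3D.Cruxes.TextureLiminf.TexShadow (stacking)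
open scoped InnerProductSpace

/-! ### Bonds of a Barlow stacking lie on `Λ₀` or on its basal twin -/

/-- **A bond of a Barlow stacking lies on `Λ₀` or on `M Λ₀`.**  `p` and `p + d` sites of `barlowStacking σ` (`σ` Hägg), `‖d‖ = 1`:
`d ∈ Λ₀` (in-layer bond, or a bond across a `+` bilayer) or `basalMirror d ∈ Λ₀` (across a `−` bilayer). -/
theorem barlow_bond_mem_or_mirror_mem {σ : ℤ → ℤ} (hσ : IsHaggSeq σ) {p d : EuclideanSpace ℝ (Fin 3)}
    (hp : p ∈ barlowStacking 1 (Real.sqrt (2 / 3)) σ) (hpd : p + d ∈ barlowStacking 1 (Real.sqrt (2 / 3)) σ) (hd : ‖d‖ = 1) :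
    d ∈ fccStacking 1 (Real.sqrt (2 / 3)) ∨ basalMirror d ∈ fccStacking 1 (Real.sqrt (2 / 3)) := by
  obtain ⟨k, i, j, rfl⟩ := mem_barlowStacking_iff.1 hp
  obtain ⟨k', i', j', hq⟩ := mem_barlowStacking_iff.1 hpd
  have hd' : d = barlowPos 1 (Real.sqrt (2 / 3)) σ k' i' j' - barlowPos 1 (Real.sqrt (2 / 3)) σ k i j := by
    rw [← hq, add_sub_cancel_left]
  have hdist : dist (barlowPos 1 (Real.sqrt (2 / 3)) σ k i j) (barlowPos 1 (Real.sqrt (2 / 3)) σ k' i' j') = 1 := by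
    rw [dist_comm, dist_eq_norm, ← hd', hd]
  have hh : Real.sqrt (2 / 3) ^ 2 = 2 / 3 * (1 : ℝ) ^ 2 := by rw [Real.sq_sqrt (by norm_num)]; ring
  rcases (dist_barlowPos_eq_iff hσ one_pos hh k i j k' i' j').1 hdist with ⟨hk, -⟩ | ⟨hk, -⟩ | ⟨hk, -⟩
  · left; rw [hd', hk, barlowPos_sub_eq_fcc]; exact mem_barlowStacking_iff.2 ⟨_, _, _, rfl⟩
  · rcases hσ k with h1 | h1
    · left; rw [hd', hk, barlowPos_succ_sub_of_pos h1]; exact mem_barlowStacking_iff.2 ⟨_, _, _, rfl⟩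
    · right; rw [hd', hk]
      show (ℝ ∙ (EuclideanSpace.single (2 : Fin 3) (1 : ℝ)))ᗮ.reflection _ ∈ _
      rw [basalMirror_barlowPos_succ_sub_of_neg h1]; exact mem_barlowStacking_iff.2 ⟨_, _, _, rfl⟩
  · rcases hσ (k - 1) with h1 | h1
    · left; rw [hd', hk, barlowPos_pred_sub_of_pos h1]; exact mem_barlowStacking_iff.2 ⟨_, _, _, rfl⟩
    · right; rw [hd', hk]
      show (ℝ ∙ (EuclideanSpace.single (2 : Fin 3) (1 : ℝ)))ᗮ.reflection _ ∈ _
      rw [basalMirror_barlowPos_pred_sub_of_neg h1]; exact mem_barlowStacking_iff.2 ⟨_, _, _, rfl⟩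

/-! ### A rigid fcc lattice never mixes out-of-plane bonds of `Λ₀` and of `M Λ₀` -/

/-- The five slot inner products are half-integers. -/
private theorem exists_int_of_mem_halves {x : ℝ} (h : x = 1 ∨ x = 1 / 2 ∨ x = 0 ∨ x = -(1 / 2) ∨ x = -1) :
    ∃ m : ℤ, x = m / 2 := by
  rcases h with h | h | h | h | h
  · exact ⟨2, by rw [h]; norm_num⟩
  · exact ⟨1, by rw [h]; norm_num⟩
  · exact ⟨0, by rw [h]; norm_num⟩
  · exact ⟨-1, by rw [h]; norm_num⟩
  · exact ⟨-2, by rw [h]; norm_num⟩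

/-- **No mixing.**  Two unit vectors `u, v` of one rigid fcc lattice `G·Λ₀` cannot be an out-of-plane bond of `Λ₀` (`u ∈ Λ₀`,
`u₂ ≠ 0`) and an out-of-plane bond of `M Λ₀` (`basalMirror v ∈ Λ₀`, `v₂ ≠ 0`): `⟪v, u⟫` and `⟪M v, u⟫ = ⟪v, u⟫ − 2 v₂ u₂` would both
be half-integers while `2 v₂ u₂ = ± 4/3`. -/
theorem false_of_bond_and_mirror_bond (G : EuclideanSpace ℝ (Fin 3) ≃ₗᵢ[ℝ] EuclideanSpace ℝ (Fin 3))
    {u v : EuclideanSpace ℝ (Fin 3)}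
    (huG : u ∈ G '' fccStacking 1 (Real.sqrt (2 / 3))) (hvG : v ∈ G '' fccStacking 1 (Real.sqrt (2 / 3)))
    (hu1 : ‖u‖ = 1) (hv1 : ‖v‖ = 1)
    (hu : u ∈ fccStacking 1 (Real.sqrt (2 / 3))) (hv : basalMirror v ∈ fccStacking 1 (Real.sqrt (2 / 3)))
    (hu2 : u 2 ≠ 0) (hv2 : v 2 ≠ 0) : False := by
  have hc2 : Real.sqrt (2 / 3) ^ 2 = 2 / 3 := Real.sq_sqrt (by norm_num)
  have hMv1 : ‖basalMirror v‖ = 1 := by rw [LinearIsometryEquiv.norm_map, hv1]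
  -- the two inner products are half-integers
  obtain ⟨m, hm⟩ := exists_int_of_mem_halves (inner_mem_of_unit_slots G hvG huG hv1 hu1)
  obtain ⟨m', hm'⟩ := exists_int_of_mem_halves
    (inner_mem_of_unit_slots (LinearIsometryEquiv.refl ℝ (EuclideanSpace ℝ (Fin 3))) ⟨basalMirror v, hv, rfl⟩ ⟨u, hu, rfl⟩
      hMv1 hu1)
  simp only [LinearIsometryEquiv.coe_refl, id_eq] at hm'
  -- heights
  obtain ⟨ku, hku, hu2'⟩ := fcc_unit_height hu hu1
  obtain ⟨kv, hkv, hv2'⟩ := fcc_unit_height hv hMv1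
  have hMv2 : (basalMirror v) 2 = -v 2 := by rw [basalMirror_apply_coord]; simp
  have hku0 : ku ≠ 0 := by
    rintro rfl; apply hu2; rw [hu2']; simp
  have hkv0 : kv ≠ 0 := by
    rintro rfl; apply hv2
    have := hv2'; rw [hMv2] at this; simp only [Int.cast_zero, zero_mul, neg_eq_zero] at this; exact this
  have hv2'' : v 2 = -(kv * Real.sqrt (2 / 3)) := by rw [← hv2', hMv2, neg_neg]
  -- `⟪M v, u⟫ = ⟪v, u⟫ − 2 v₂ u₂`
  have key : (⟪basalMirror v, u⟫_ℝ : ℝ) = ⟪v, u⟫_ℝ - 2 * v 2 * u 2 := inner_basalMirror_left v u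
  rw [hm', hm, hu2', hv2''] at key
  have key' : (m' : ℝ) / 2 = m / 2 + 2 * (kv * ku) * Real.sqrt (2 / 3) ^ 2 := by rw [key]; ring
  rw [hc2] at key'
  have hint : (3 * m' : ℤ) = 3 * m + 8 * (kv * ku) := by
    have : (3 * m' : ℝ) = 3 * m + 8 * (kv * ku) := by linarith
    exact_mod_cast this
  rcases hku with rfl | rfl | rfl <;> rcases hkv with rfl | rfl | rfl <;> omega

/-! ### Barlow star rigidity -/

/-- **Barlow star rigidity (model plate).**  A frame `G` with three linearly independent slots `a b c` that are EXACT at a site `p`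
of `barlowStacking σ` (`p + G a`, `p + G b`, `p + G c` are sites) carries the bilayer lattice or its basal twin:
`G·Λ₀ = Λ₀ ∨ G·Λ₀ = M·Λ₀`.  (At a c-site all bonds lie on one of them; at an h-site the up-bonds lie on one and the down-bonds on the
other, and `false_of_bond_and_mirror_bond` forbids using both.) -/
theorem barlow_frame_eq_or_eq_mirror {σ : ℤ → ℤ} (hσ : IsHaggSeq σ)
    (G : EuclideanSpace ℝ (Fin 3) ≃ₗᵢ[ℝ] EuclideanSpace ℝ (Fin 3)) {p : EuclideanSpace ℝ (Fin 3)}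
    (hp : p ∈ barlowStacking 1 (Real.sqrt (2 / 3)) σ) {a b c : EuclideanSpace ℝ (Fin 3)}
    (ha : a ∈ fccSlots) (hb : b ∈ fccSlots) (hc : c ∈ fccSlots) (hind : LinearIndependent ℝ ![a, b, c])
    (haS : p + G a ∈ barlowStacking 1 (Real.sqrt (2 / 3)) σ) (hbS : p + G b ∈ barlowStacking 1 (Real.sqrt (2 / 3)) σ)
    (hcS : p + G c ∈ barlowStacking 1 (Real.sqrt (2 / 3)) σ) :
    G '' fccStacking 1 (Real.sqrt (2 / 3)) = fccStacking 1 (Real.sqrt (2 / 3)) ∨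
      G '' fccStacking 1 (Real.sqrt (2 / 3)) = basalMirror '' fccStacking 1 (Real.sqrt (2 / 3)) := by
  have hn : ∀ {w : EuclideanSpace ℝ (Fin 3)}, w ∈ fccSlots → ‖G w‖ = 1 := fun hw => by
    rw [LinearIsometryEquiv.norm_map, norm_eq_one_of_mem_fccSlots hw]
  have hGmem : ∀ {w : EuclideanSpace ℝ (Fin 3)}, w ∈ fccSlots → G w ∈ G '' fccStacking 1 (Real.sqrt (2 / 3)) :=
    fun hw => ⟨_, mem_fcc_of_mem_fccSlots hw, rfl⟩
  have hcls : ∀ {w : EuclideanSpace ℝ (Fin 3)}, w ∈ fccSlots → p + G w ∈ barlowStacking 1 (Real.sqrt (2 / 3)) σ →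
      G w ∈ fccStacking 1 (Real.sqrt (2 / 3)) ∨ basalMirror (G w) ∈ fccStacking 1 (Real.sqrt (2 / 3)) :=
    fun hw hwS => barlow_bond_mem_or_mirror_mem hσ hp hwS (hn hw)
  -- in-plane bonds are on both lattices, so a bond off one of them is out of plane
  have hnz : ∀ {d : EuclideanSpace ℝ (Fin 3)},
      (d ∈ fccStacking 1 (Real.sqrt (2 / 3)) ∨ basalMirror d ∈ fccStacking 1 (Real.sqrt (2 / 3))) →
      d ∉ fccStacking 1 (Real.sqrt (2 / 3)) → d 2 ≠ 0 := by
    intro d hd hnd h0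
    rcases hd with hd | hd
    · exact hnd hd
    · rw [basalMirror_of_inPlane h0] at hd; exact hnd hd
  have hnz' : ∀ {d : EuclideanSpace ℝ (Fin 3)},
      (d ∈ fccStacking 1 (Real.sqrt (2 / 3)) ∨ basalMirror d ∈ fccStacking 1 (Real.sqrt (2 / 3))) →
      basalMirror d ∉ fccStacking 1 (Real.sqrt (2 / 3)) → d 2 ≠ 0 := by
    intro d hd hnd h0
    rcases hd with hd | hd
    · rw [basalMirror_of_inPlane h0] at hnd; exact hnd hd
    · exact hnd hd
  by_cases hA : G a ∈ fccStacking 1 (Real.sqrt (2 / 3)) ∧ G b ∈ fccStacking 1 (Real.sqrt (2 / 3)) ∧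
      G c ∈ fccStacking 1 (Real.sqrt (2 / 3))
  · left
    have key := movedFcc_eq_of_three_independent_units G (LinearIsometryEquiv.refl ℝ (EuclideanSpace ℝ (Fin 3)))
      (hGmem ha) (hGmem hb) (hGmem hc) ⟨_, hA.1, rfl⟩ ⟨_, hA.2.1, rfl⟩ ⟨_, hA.2.2, rfl⟩ (hn ha) (hn hb) (hn hc)
      (linearIndependent_map_triple G hind)
    rw [key, LinearIsometryEquiv.coe_refl, Set.image_id]
  by_cases hB : basalMirror (G a) ∈ fccStacking 1 (Real.sqrt (2 / 3)) ∧ basalMirror (G b) ∈ fccStacking 1 (Real.sqrt (2 / 3)) ∧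
      basalMirror (G c) ∈ fccStacking 1 (Real.sqrt (2 / 3))
  · right
    have hmem : ∀ {d : EuclideanSpace ℝ (Fin 3)}, basalMirror d ∈ fccStacking 1 (Real.sqrt (2 / 3)) →
        d ∈ basalMirror '' fccStacking 1 (Real.sqrt (2 / 3)) := fun {d} hd =>
      ⟨basalMirror d, hd, Submodule.reflection_reflection _ _⟩
    exact movedFcc_eq_of_three_independent_units G basalMirror (hGmem ha) (hGmem hb) (hGmem hc)
      (hmem hB.1) (hmem hB.2.1) (hmem hB.2.2) (hn ha) (hn hb) (hn hc) (linearIndependent_map_triple G hind)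
  exfalso
  -- a bond on `Λ₀` off `M Λ₀`, and a bond on `M Λ₀` off `Λ₀`
  obtain ⟨u, huG, hu1, hu, hu2⟩ : ∃ u, u ∈ G '' fccStacking 1 (Real.sqrt (2 / 3)) ∧ ‖u‖ = 1 ∧
      u ∈ fccStacking 1 (Real.sqrt (2 / 3)) ∧ u 2 ≠ 0 := by
    simp only [not_and_or] at hB
    rcases hB with h | h | h
    · exact ⟨G a, hGmem ha, hn ha, (hcls ha haS).resolve_right h, hnz' (hcls ha haS) h⟩
    · exact ⟨G b, hGmem hb, hn hb, (hcls hb hbS).resolve_right h, hnz' (hcls hb hbS) h⟩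
    · exact ⟨G c, hGmem hc, hn hc, (hcls hc hcS).resolve_right h, hnz' (hcls hc hcS) h⟩
  obtain ⟨v, hvG, hv1, hv, hv2⟩ : ∃ v, v ∈ G '' fccStacking 1 (Real.sqrt (2 / 3)) ∧ ‖v‖ = 1 ∧
      basalMirror v ∈ fccStacking 1 (Real.sqrt (2 / 3)) ∧ v 2 ≠ 0 := by
    simp only [not_and_or] at hA
    rcases hA with h | h | h
    · exact ⟨G a, hGmem ha, hn ha, (hcls ha haS).resolve_left h, hnz (hcls ha haS) h⟩
    · exact ⟨G b, hGmem hb, hn hb, (hcls hb hbS).resolve_left h, hnz (hcls hb hbS) h⟩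
    · exact ⟨G c, hGmem hc, hn hc, (hcls hc hcS).resolve_left h, hnz (hcls hc hcS) h⟩
  exact false_of_bond_and_mirror_bond G huG hvG hu1 hv1 hu hv hu2 hv2

/-- **Barlow star rigidity (moved plate).**  For the plate `stacking L s σ`: a frame `F` with three linearly independent exact
slots at a plate site `y` has `F·Λ₀ = L·Λ₀` or `F·Λ₀ = (twinFrame L (L e₃))·Λ₀` (the basal twin moved by `L`). -/
theorem barlow_frame_eq_or_eq_twin {σ : ℤ → ℤ} (hσ : IsHaggSeq σ)
    (L : EuclideanSpace ℝ (Fin 3) ≃ₗᵢ[ℝ] EuclideanSpace ℝ (Fin 3)) (s : EuclideanSpace ℝ (Fin 3))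
    (F : EuclideanSpace ℝ (Fin 3) ≃ₗᵢ[ℝ] EuclideanSpace ℝ (Fin 3)) {y : EuclideanSpace ℝ (Fin 3)} (hy : y ∈ stacking L s σ)
    {a b c : EuclideanSpace ℝ (Fin 3)} (ha : a ∈ fccSlots) (hb : b ∈ fccSlots) (hc : c ∈ fccSlots)
    (hind : LinearIndependent ℝ ![a, b, c])
    (haS : y + F a ∈ stacking L s σ) (hbS : y + F b ∈ stacking L s σ) (hcS : y + F c ∈ stacking L s σ) :
    F '' fccStacking 1 (Real.sqrt (2 / 3)) = L '' fccStacking 1 (Real.sqrt (2 / 3)) ∨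
      F '' fccStacking 1 (Real.sqrt (2 / 3)) =
        (twinFrame L (L (EuclideanSpace.single (2 : Fin 3) (1 : ℝ)))) '' fccStacking 1 (Real.sqrt (2 / 3)) := by
  obtain ⟨p, hp, hpy⟩ := hy
  dsimp only at hpy
  set G := F.trans L.symm with hG
  have hGw : ∀ {w : EuclideanSpace ℝ (Fin 3)}, y + F w ∈ stacking L s σ → p + G w ∈ barlowStacking 1 (Real.sqrt (2 / 3)) σ := by
    intro w hw
    obtain ⟨q, hq, hqy⟩ := hw
    dsimp only at hqy
    have hFw : F w = L (q - p) := by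
      rw [map_sub, eq_sub_of_add_eq' hqy.symm, ← hpy]; abel
    have : G w = q - p := by
      rw [hG, LinearIsometryEquiv.trans_apply, hFw, LinearIsometryEquiv.symm_apply_apply]
    rw [this, add_sub_cancel]; exact hq
  have hFG : (F : EuclideanSpace ℝ (Fin 3) → EuclideanSpace ℝ (Fin 3)) = fun x => L (G x) := by
    funext x; rw [hG, LinearIsometryEquiv.trans_apply, LinearIsometryEquiv.apply_symm_apply]
  rcases barlow_frame_eq_or_eq_mirror hσ G hp ha hb hc hind (hGw haS) (hGw hbS) (hGw hcS) with h | h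
  · left; rw [hFG, ← Set.image_image, h]
  · right; rw [hFG, ← Set.image_image, h, Set.image_image]
    congr 1; funext x; exact (twinFrame_axis_apply L x).symm

end Summit.Ventures.Crystal3D.Theorems

end
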